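/-
Copyright: b2b-lace packet (LEAN TYPING SEAT 1 gen 35, node KU-SEP-SINKEPT-LITBOUND, a leaf under
KU-SEP-SINKEPT-BALL). The LITERAL-READY (scalar) form of the kept-slice budgets of `SrwTwistKeptSliceBudget`:
the bracket `[((1+2δ_J)^d − 1) + (Π_μ(α′_μ+η_μ) − Π_μ α′_μ)/(2π)^d]` is majorised by
`((1+2δ̄)^d − 1) + ((A+ρ)^d − A^d)` from the scalar bounds `δ_J ≤ δ̄`, `α′_μ ≤ 2πA`, `η_μ ≤ 2πρ`, and the
kept seed by ONE plain-seed literal; a shared real / rational literal table gives `A = Σ_j ε_j |q_j|`,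
`ρ = (2J+1)e`, and the `ℚ`-cast shape a kernel-decided consumer inequality uses. d-generic; number-free; def-free;
what-if / input-certification lane SUPPORT; nothing here is a certificate; no statement at any fixed dimension.
-/
import Literature.Probability.FitznerVanDerHofstad2017.SrwTwistKeptSliceBudget
import Literature.Probability.FitznerVanDerHofstad2017.SrwIntegralJFarField
import Literature.Analysis.FunctionSpaces.BesselJLiteralCert
import HarnessLib

/-!
# The kept-slice budget with literal (scalar) inputs

CITATION HEADER (PLACEMENT v2). Part of the certified REPRODUCTION of the numerical inputs of
R. Fitzner, R. van der Hofstad, *Generalized approach to the non-backtracking lace expansion*,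
Probab. Theory Related Fields 169 (2017) 1041–1119 [NoBLE17-I] (arXiv:1506.07969): the SRW Fourier
integrals (3.34)–(3.38) p. 1071 evaluated through Bessel rows, §5.1.1 (5.2)–(5.5) pp. 1089–1090 and
§5.2 (5.9)–(5.10) p. 1092 (the notebook `SRW.nb`); Bessel facts from NIST DLMF §10.2.2 [DLMF].
Nothing in this file is a claim of the paper beyond those formulas; everything below is PROVED.

## What this module adds

`SrwTwistKeptSliceBudget` (node KU-SEP-SINKEPT-BALL, part B) proves, for every sin²-kept cosine-power
product slice in the sharp range `2n+3 ≤ d` (`m ≠ 0`, any exponents `a`, truncation order `J`, any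
per-coordinate literal table `c′ : Fin d → ℕ → ℂ`), the consumer forms
`abs_srwTwist_prodCosPowSinSq_sub_recurrenceLitObj_le` (one kept factor) and
`abs_srwTwist_prodCosPowSinSqSinSq_sub_recurrenceLitObj_le` (two kept factors / sin⁴):

`|slice − K · Obj_n(P̃(c′))| ≤ [((1 + 2δ_J(β/d))^d − 1) + (Π_μ(α′_μ+η_μ) − Π_μ α′_μ)/(2π)^d] · K′ · seed`,

`δ_J(y) = Σ_{l≥0}|J_{l+J+1}(y)|`, `α′_μ = Σ_{j≤J} ε_j‖c′_{μ,j}‖`, `η_μ = Σ_{j≤J} ε_j‖2π iʲ J_j(β/d) − c′_{μ,j}‖`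
(`ε_0 = 1`, `ε_j = 2`), `seed = srwI d (n+1) 0 (e_{j₀})` resp. `srwI d (n+1) 0 (e_{j₀}+e_{j₁})`,
`K′ = d/(n+1)` resp. `c·d²/((n+1)(n+2))` (`c = 3` if `j₀ = j₁`, else `1`).
The bracket still contains the real numbers `δ_J`, `J_j(β/d)` and a product over the `d` coordinates.  This
module reduces it to SCALARS a consumer can supply as literals — the kept-row analogue of
`SeedCert.TwCert.truncErrT_le` / `truncErrT_zero_le_cast` (module `SrwTwistSeedCertRowBound`):

* `keptBracket_le_of_le` — the pure inequality: `0 ≤ δ ≤ δ̄`, `0 ≤ α_μ ≤ 2πA`, `0 ≤ η_μ ≤ 2πρ` give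
  `((1+2δ)^d − 1) + (Π_μ(α_μ+η_μ) − Π_μ α_μ)/(2π)^d ≤ ((1+2δ̄)^d − 1) + ((A+ρ)^d − A^d)`
  (monotonicity of the product increment in both arguments; the powers of `2π` cancel exactly);
* **`abs_srwTwist_prodCosPowSinSq_sub_recurrenceLitObj_le_of_le`** and the two-kept twin
  **`abs_srwTwist_prodCosPowSinSqSinSq_sub_recurrenceLitObj_le_of_le`**: with `δ_J(β/d) ≤ δ̄`,
  `α′_μ ≤ 2πA`, `η_μ ≤ 2πρ` for every `μ`, and ONE seed literal `seed ≤ I`, the budget is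
  `≤ (((1+2δ̄)^d − 1) + ((A+ρ)^d − A^d)) · K′ · I`;
* the SHARED-TABLE corollaries `…_of_lit` (`c′_{μ,j} = 2π iʲ q_j`, `q : ℕ → ℝ`, `|q_j − J_j(β/d)| ≤ e` for
  `j ≤ J` ⇒ `A = |q_0| + 2Σ_{1≤j≤J}|q_j|`, `ρ = (2J+1)e`, by `JLit.norm_coeff_sub_coeff_le`), and the
  rational shapes `…_of_lit_cast` (`q : ℕ → ℚ`, `δ̄, e, I ∈ ℚ`):
  `budget ≤ (((((1+2δ̄)^d − 1) + ((A + (2J+1)e)^d − A^d)) · (K′ · I) : ℚ) : ℝ)` with the whole right-hand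
  side ONE rational expression in the literals, the shape a kernel-decided literal inequality consumes.

The scalar inputs have tree sources: `δ̄` from `BesselJOrderTailGeometric` /
`tsum_abs_besselJ_tail_le_of_abs_le_one` (`SrwTwistRowOrderBall`), `e` from a decided `JLit.Cert`
(`BesselJLiteralCert`), `I` from a decided SEEDCERT class certificate at the class of `e_{j₀}` resp.
`e_{j₀}+e_{j₁}`.  Everything is PROVED (standard axioms), generic in the dimension `d` and number-free:
def-free, no instance, no table, no named fact.  Epistemic status / lane:
what-if / input-certification SUPPORT; nothing here is a certificate; no statement at a specific dimension.

## References
* R. Fitzner, R. van der Hofstad, *Generalized approach to the non-backtracking lace expansion*,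
  PTRF 169 (2017) 1041–1119 (arXiv:1506.07969), (3.34)–(3.38) p. 1071, §5.1.1 (5.2)–(5.5) pp. 1089–1090,
  §5.2 (5.9)–(5.10) p. 1092. [FitznerVanDerHofstad2016NoBLE]
* NIST DLMF §10.2.2. [DLMF]
[cite: FitznerVanDerHofstad2016NoBLE, (3.34)–(3.38) p. 1071, §5.1.1 (5.2)–(5.5) pp. 1089–1090, §5.2 (5.9)–(5.10) p. 1092; DLMF, 10.2.2]
-/

noncomputable section

open MeasureTheory Set Real
open scoped Nat

namespace Literature.Probability.FitznerVanDerHofstad2017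

open Literature.Probability.LatticeModels (besselI)
open Literature.Analysis.FunctionSpaces (besselJ)

variable {d : ℕ}

/-! ### The scalar majorant of the bracket -/

/-- Monotonicity of the product increment in the base point: `Π(x_i+ρ_i) − Π x_i ≤ Π(α_i+ρ_i) − Π α_i`
for `0 ≤ x_i ≤ α_i`, `0 ≤ ρ_i`. [folklore] -/
private theorem prod_add_sub_prod_mono_base {ι : Type*} (s : Finset ι) (x α ρ : ι → ℝ)
    (hx0 : ∀ i ∈ s, 0 ≤ x i) (hxα : ∀ i ∈ s, x i ≤ α i) (hρ : ∀ i ∈ s, 0 ≤ ρ i) :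
    ∏ i ∈ s, (x i + ρ i) - ∏ i ∈ s, x i ≤ ∏ i ∈ s, (α i + ρ i) - ∏ i ∈ s, α i := by
  classical
  induction s using Finset.induction_on with
  | empty => simp
  | insert j s hj ih =>
    have hx0' : ∀ i ∈ s, 0 ≤ x i := fun i hi => hx0 i (Finset.mem_insert_of_mem hi)
    have hxα' : ∀ i ∈ s, x i ≤ α i := fun i hi => hxα i (Finset.mem_insert_of_mem hi)
    have hρ' : ∀ i ∈ s, 0 ≤ ρ i := fun i hi => hρ i (Finset.mem_insert_of_mem hi)
    have ih' := ih hx0' hxα' hρ'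
    have hxj0 : 0 ≤ x j := hx0 j (Finset.mem_insert_self j s)
    have hxjα : x j ≤ α j := hxα j (Finset.mem_insert_self j s)
    have hρj : 0 ≤ ρ j := hρ j (Finset.mem_insert_self j s)
    rw [Finset.prod_insert hj, Finset.prod_insert hj, Finset.prod_insert hj, Finset.prod_insert hj]
    set Pp := ∏ i ∈ s, (x i + ρ i)
    set P0 := ∏ i ∈ s, x i
    set Ap := ∏ i ∈ s, (α i + ρ i)
    set A0 := ∏ i ∈ s, α i
    have hP0P : P0 ≤ Pp := Finset.prod_le_prod hx0' (fun i hi => by linarith [hρ' i hi])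
    have hPpA : Pp ≤ Ap :=
      Finset.prod_le_prod (fun i hi => by linarith [hx0' i hi, hρ' i hi])
        (fun i hi => by linarith [hxα' i hi])
    have hD0 : 0 ≤ Ap - A0 := (sub_nonneg.2 hP0P).trans ih'
    have e1 : x j * (Pp - P0) ≤ α j * (Ap - A0) :=
      (mul_le_mul_of_nonneg_left ih' hxj0).trans (mul_le_mul_of_nonneg_right hxjα hD0)
    have e2 : ρ j * Pp ≤ ρ j * Ap := mul_le_mul_of_nonneg_left hPpA hρj
    calc (x j + ρ j) * Pp - x j * P0 = x j * (Pp - P0) + ρ j * Pp := by ring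
      _ ≤ α j * (Ap - A0) + ρ j * Ap := add_le_add e1 e2
      _ = (α j + ρ j) * Ap - α j * A0 := by ring

/-- **The scalar majorant of the kept bracket.** For `0 ≤ δ ≤ δ̄` and, coordinatewise, `0 ≤ α_μ ≤ 2πA`,
`0 ≤ η_μ ≤ 2πρ`:
`((1+2δ)^d − 1) + (Π_μ(α_μ+η_μ) − Π_μ α_μ)/(2π)^d ≤ ((1+2δ̄)^d − 1) + ((A+ρ)^d − A^d)`
(the product increment is monotone in both arguments; the powers of `2π` cancel exactly).
[cite: FitznerVanDerHofstad2016NoBLE, (3.34)–(3.38) p. 1071, §5.1.1 (5.2)–(5.5) pp. 1089–1090, §5.2 (5.9)–(5.10) p. 1092; DLMF, 10.2.2] -/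
theorem keptBracket_le_of_le (δ δb A ρ : ℝ) (α η : Fin d → ℝ) (hδ0 : 0 ≤ δ) (hδ : δ ≤ δb)
    (hα0 : ∀ μ, 0 ≤ α μ) (hα : ∀ μ, α μ ≤ 2 * π * A) (hη0 : ∀ μ, 0 ≤ η μ)
    (hη : ∀ μ, η μ ≤ 2 * π * ρ) :
    ((1 + 2 * δ) ^ d - 1) + ((∏ μ, (α μ + η μ)) - ∏ μ, α μ) / (2 * π) ^ d
      ≤ ((1 + 2 * δb) ^ d - 1) + ((A + ρ) ^ d - A ^ d) := by
  have h2π : (0 : ℝ) < 2 * π := by positivity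
  have h1 : (1 + 2 * δ) ^ d - 1 ≤ (1 + 2 * δb) ^ d - 1 :=
    sub_le_sub_right (pow_le_pow_left₀ (by linarith) (by linarith) d) 1
  -- monotonicity in `η`
  have hPη : ∏ μ, (α μ + η μ) ≤ ∏ μ, (α μ + 2 * π * ρ) :=
    Finset.prod_le_prod (fun μ _ => add_nonneg (hα0 μ) (hη0 μ)) (fun μ _ => by linarith [hη μ])
  -- monotonicity in `α`
  have hPα : (∏ μ, (α μ + 2 * π * ρ)) - ∏ μ, α μ
      ≤ (∏ _μ : Fin d, (2 * π * A + 2 * π * ρ)) - ∏ _μ : Fin d, (2 * π * A) :=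
    prod_add_sub_prod_mono_base Finset.univ α (fun _ => 2 * π * A) (fun _ => 2 * π * ρ)
      (fun μ _ => hα0 μ) (fun μ _ => hα μ) (fun μ _ => by linarith [hη0 μ, hη μ])
  have hconst : (∏ _μ : Fin d, (2 * π * A + 2 * π * ρ)) - ∏ _μ : Fin d, (2 * π * A)
      = (2 * π) ^ d * ((A + ρ) ^ d - A ^ d) := by
    rw [Finset.prod_const, Finset.prod_const, Finset.card_univ, Fintype.card_fin,
      show 2 * π * A + 2 * π * ρ = 2 * π * (A + ρ) by ring, mul_pow, mul_pow]
    ring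
  have hnum : (∏ μ, (α μ + η μ)) - ∏ μ, α μ ≤ (2 * π) ^ d * ((A + ρ) ^ d - A ^ d) := by
    rw [← hconst]; linarith
  have h2 : ((∏ μ, (α μ + η μ)) - ∏ μ, α μ) / (2 * π) ^ d ≤ (A + ρ) ^ d - A ^ d := by
    rw [div_le_iff₀ (pow_pos h2π d), mul_comm]
    exact hnum
  exact add_le_add h1 h2

/-- The kept bracket is nonnegative: `0 ≤ ((1+2δ)^d − 1) + (Π_μ(α_μ+η_μ) − Π_μ α_μ)/(2π)^d` for `0 ≤ δ`,
`0 ≤ α_μ`, `0 ≤ η_μ`. [cite: FitznerVanDerHofstad2016NoBLE, (3.34)–(3.38) p. 1071, §5.1.1 (5.2)–(5.5) pp. 1089–1090, §5.2 (5.9)–(5.10) p. 1092; DLMF, 10.2.2] -/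
theorem keptBracket_nonneg (δ : ℝ) (α η : Fin d → ℝ) (hδ0 : 0 ≤ δ) (hα0 : ∀ μ, 0 ≤ α μ)
    (hη0 : ∀ μ, 0 ≤ η μ) :
    0 ≤ ((1 + 2 * δ) ^ d - 1) + ((∏ μ, (α μ + η μ)) - ∏ μ, α μ) / (2 * π) ^ d := by
  have h2π : (0 : ℝ) < 2 * π := by positivity
  have h1 : 0 ≤ (1 + 2 * δ) ^ d - 1 := sub_nonneg.2 (one_le_pow₀ (by linarith))
  have hP : ∏ μ, α μ ≤ ∏ μ, (α μ + η μ) :=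
    Finset.prod_le_prod (fun μ _ => hα0 μ) (fun μ _ => by linarith [hη0 μ])
  exact add_nonneg h1 (div_nonneg (sub_nonneg.2 hP) (pow_nonneg h2π.le d))

/-! ### Shared literal tables: the row mass and the coefficient error -/

/-- `Σ_{j ≤ K} ε_j = 2K + 1` (`ε_0 = 1`, `ε_j = 2`). [folklore] -/
private theorem sum_rowEps_eq (K : ℕ) :
    ∑ j ∈ Finset.range (K + 1), (if j = 0 then (1 : ℝ) else 2) = 2 * K + 1 := by
  induction K with
  | zero => simp
  | succ K ih =>
    rw [Finset.sum_range_succ, ih, if_neg (Nat.succ_ne_zero K)]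
    push_cast; ring

/-- **Row mass of a shared literal table.** For `q : ℕ → ℝ` and `c_j = 2π iʲ q_j`:
`Σ_{j ≤ J} ε_j ‖c_j‖ = 2π (|q_0| + 2 Σ_{1 ≤ j ≤ J} |q_j|)`. [cite: FitznerVanDerHofstad2016NoBLE, (3.34)–(3.38) p. 1071, §5.1.1 (5.2)–(5.5) pp. 1089–1090, §5.2 (5.9)–(5.10) p. 1092; DLMF, 10.2.2] -/
theorem sum_weight_norm_lit_eq (J : ℕ) (q : ℕ → ℝ) :
    ∑ j ∈ Finset.range (J + 1), (if j = 0 then (1 : ℝ) else 2) * ‖2 * π * Complex.I ^ j * ((q j : ℝ) : ℂ)‖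
      = 2 * π * (|q 0| + 2 * ∑ j ∈ Finset.range J, |q (j + 1)|) := by
  have hn : ∀ j : ℕ, ‖2 * π * Complex.I ^ j * ((q j : ℝ) : ℂ)‖ = 2 * π * |q j| := by
    intro j
    rw [norm_mul, norm_mul, norm_pow, Complex.norm_I, one_pow, mul_one, Complex.norm_real,
      Real.norm_eq_abs]
    have h2 : ‖(2 : ℂ) * π‖ = 2 * π := by
      rw [norm_mul, Complex.norm_real, Real.norm_eq_abs, abs_of_pos Real.pi_pos]
      simp
    rw [h2]
  simp_rw [hn]
  rw [Finset.sum_range_succ', if_pos rfl]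
  have hne : ∀ j : ℕ, (if j + 1 = 0 then (1 : ℝ) else 2) = 2 := fun j => if_neg (Nat.succ_ne_zero j)
  simp_rw [hne]
  have : ∑ j ∈ Finset.range J, (2 : ℝ) * (2 * π * |q (j + 1)|)
      = 2 * π * (2 * ∑ j ∈ Finset.range J, |q (j + 1)|) := by
    rw [Finset.mul_sum, Finset.mul_sum]
    exact Finset.sum_congr rfl fun j _ => by ring
  rw [this]
  ring

/-- **Coefficient error of a shared literal table.** If `|q_j − J_j(β/d)| ≤ e` for `j ≤ J`, then
`Σ_{j ≤ J} ε_j ‖2π iʲ J_j(β/d) − 2π iʲ q_j‖ ≤ 2π (2J+1) e` (`JLit.norm_coeff_sub_coeff_le`).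
[cite: FitznerVanDerHofstad2016NoBLE, (3.34)–(3.38) p. 1071, §5.1.1 (5.2)–(5.5) pp. 1089–1090, §5.2 (5.9)–(5.10) p. 1092; DLMF, 10.2.2] -/
theorem sum_weight_norm_coeff_sub_lit_le (J : ℕ) (q : ℕ → ℝ) (y e : ℝ)
    (he : ∀ j ∈ Finset.range (J + 1), |q j - besselJ j y| ≤ e) :
    ∑ j ∈ Finset.range (J + 1), (if j = 0 then (1 : ℝ) else 2)
        * ‖2 * π * Complex.I ^ j * (besselJ j y : ℂ) - 2 * π * Complex.I ^ j * ((q j : ℝ) : ℂ)‖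
      ≤ 2 * π * ((2 * J + 1) * e) := by
  have hw : ∀ j : ℕ, (0 : ℝ) ≤ (if j = 0 then (1 : ℝ) else 2) := fun j => by split_ifs <;> norm_num
  calc ∑ j ∈ Finset.range (J + 1), (if j = 0 then (1 : ℝ) else 2)
          * ‖2 * π * Complex.I ^ j * (besselJ j y : ℂ) - 2 * π * Complex.I ^ j * ((q j : ℝ) : ℂ)‖
      ≤ ∑ j ∈ Finset.range (J + 1), (if j = 0 then (1 : ℝ) else 2) * (2 * π * e) :=
        Finset.sum_le_sum fun j hj => mul_le_mul_of_nonneg_left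
          (Literature.Analysis.FunctionSpaces.JLit.norm_coeff_sub_coeff_le j (he j hj)) (hw j)
    _ = 2 * π * ((2 * J + 1) * e) := by rw [← Finset.sum_mul, sum_rowEps_eq]; ring

/-! ### The one-kept budget with scalar inputs -/

/-- **One-kept budget from four scalars.** For `2n+3 ≤ d`, `m ≠ 0`, exponents `a`, kept `sin²` at `j₀`,
truncation order `J`, literal table `c′`: if `δ_J(β/d) ≤ δ̄`, `α′_μ ≤ 2πA` and `η_μ ≤ 2πρ` for every `μ`, and
`srwI d (n+1) 0 (e_{j₀}) ≤ I`, then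
`|Tw_{n+2}[Π_μ cos^{a_μ} sin²_{j₀}](m e_i; β) − (d/(2(n+1)))·Obj_n(P̃(c′))| ≤ (((1+2δ̄)^d − 1) + ((A+ρ)^d − A^d))·((d/(n+1))·I)`.
[cite: FitznerVanDerHofstad2016NoBLE, (3.34)–(3.38) p. 1071, §5.1.1 (5.2)–(5.5) pp. 1089–1090, §5.2 (5.9)–(5.10) p. 1092; DLMF, 10.2.2] -/
theorem abs_srwTwist_prodCosPowSinSq_sub_recurrenceLitObj_le_of_le (n : ℕ) (hd : 2 * n + 3 ≤ d)
    (i j0 : Fin d) {m : ℤ} (hm : m ≠ 0) (β : ℝ) (a : Fin d → ℕ) (J : ℕ) (c' : Fin d → ℕ → ℂ)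
    {δb A ρ I : ℝ}
    (hδ : ∑' l : ℕ, |besselJ (l + J + 1) (β / d)| ≤ δb)
    (hα : ∀ μ, ∑ j ∈ Finset.range (J + 1), (if j = 0 then (1 : ℝ) else 2) * ‖c' μ j‖ ≤ 2 * π * A)
    (hη : ∀ μ, ∑ j ∈ Finset.range (J + 1), (if j = 0 then (1 : ℝ) else 2)
      * ‖2 * π * Complex.I ^ j * (besselJ j (β / d) : ℂ) - c' μ j‖ ≤ 2 * π * ρ)
    (hI : srwI d (n + 1) 0 (Pi.single j0 1) ≤ I) :
    |srwTwist d (n + 2) (fun k => ∏ μ, Real.cos (k μ) ^ a μ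
        * (if μ = j0 then Real.sin (k μ) ^ 2 else 1)) (Pi.single i m) β
      - (d : ℝ) / (2 * (n + 1)) * ((n ! : ℝ)⁻¹ * (∫ τ in Ioi (0:ℝ), τ ^ n * (Real.exp (-τ) *
        (∏ μ, ∑ j ∈ Finset.range (J + 1), (if j = 0 then (1 : ℂ) else 2)
          * ((if μ = j0 then
              ∑ s ∈ Finset.range (a μ + 1), (((a μ).choose s : ℂ) / 2 ^ (a μ))
                    * ((((j * m - ((2 * (s : ℤ) - (a μ : ℕ) : ℤ)) : ℤ) + 1)
                        * besselI (j * m - ((2 * (s : ℤ) - (a μ : ℕ) : ℤ)) + 1) (τ / d)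
                        - ((j * m - ((2 * (s : ℤ) - (a μ : ℕ) : ℤ)) : ℤ) - 1)
                            * besselI (j * m - ((2 * (s : ℤ) - (a μ : ℕ) : ℤ)) - 1) (τ / d) : ℝ) : ℂ)
             else
              ∑ s ∈ Finset.range (a μ + 1), (((a μ).choose s : ℂ) / 2 ^ (a μ))
                    * (besselI (j * m - ((2 * (s : ℤ) - (a μ : ℕ) : ℤ))) (τ / d) : ℂ))
            * c' μ j)).re)) / (2 * π) ^ d)|
    ≤ (((1 + 2 * δb) ^ d - 1) + ((A + ρ) ^ d - A ^ d)) * ((d : ℝ) / (n + 1) * I) := by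
  have hd' : 2 * (n + 1) + 1 ≤ d := by omega
  have hw : ∀ j : ℕ, (0 : ℝ) ≤ (if j = 0 then (1 : ℝ) else 2) := fun j => by split_ifs <;> norm_num
  have hδ0 : 0 ≤ ∑' l : ℕ, |besselJ (l + J + 1) (β / d)| := tsum_nonneg fun _ => abs_nonneg _
  have hα0 : ∀ μ : Fin d, 0 ≤ ∑ j ∈ Finset.range (J + 1), (if j = 0 then (1 : ℝ) else 2) * ‖c' μ j‖ :=
    fun μ => Finset.sum_nonneg fun j _ => mul_nonneg (hw j) (norm_nonneg _)
  have hη0 : ∀ μ : Fin d, 0 ≤ ∑ j ∈ Finset.range (J + 1), (if j = 0 then (1 : ℝ) else 2)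
      * ‖2 * π * Complex.I ^ j * (besselJ j (β / d) : ℂ) - c' μ j‖ :=
    fun μ => Finset.sum_nonneg fun j _ => mul_nonneg (hw j) (norm_nonneg _)
  have hB := keptBracket_le_of_le (d := d) (∑' l : ℕ, |besselJ (l + J + 1) (β / d)|) δb A ρ
    (fun μ => ∑ j ∈ Finset.range (J + 1), (if j = 0 then (1 : ℝ) else 2) * ‖c' μ j‖)
    (fun μ => ∑ j ∈ Finset.range (J + 1), (if j = 0 then (1 : ℝ) else 2)
      * ‖2 * π * Complex.I ^ j * (besselJ j (β / d) : ℂ) - c' μ j‖)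
    hδ0 hδ hα0 hα hη0 hη
  have hB0 := keptBracket_nonneg (d := d) (∑' l : ℕ, |besselJ (l + J + 1) (β / d)|)
    (fun μ => ∑ j ∈ Finset.range (J + 1), (if j = 0 then (1 : ℝ) else 2) * ‖c' μ j‖)
    (fun μ => ∑ j ∈ Finset.range (J + 1), (if j = 0 then (1 : ℝ) else 2)
      * ‖2 * π * Complex.I ^ j * (besselJ j (β / d) : ℂ) - c' μ j‖)
    hδ0 hα0 hη0
  have hS0 : 0 ≤ (d : ℝ) / (n + 1) * srwI d (n + 1) 0 (Pi.single j0 1) :=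
    mul_nonneg (by positivity) (srwI_nonneg (d := d) (n + 1) hd' 0 _)
  have hS : (d : ℝ) / (n + 1) * srwI d (n + 1) 0 (Pi.single j0 1) ≤ (d : ℝ) / (n + 1) * I :=
    mul_le_mul_of_nonneg_left hI (by positivity)
  exact (abs_srwTwist_prodCosPowSinSq_sub_recurrenceLitObj_le n hd i j0 hm β a J c').trans
    (mul_le_mul hB hS hS0 (hB0.trans hB))

/-! ### The two-kept budget with scalar inputs -/

/-- **Two-kept budget from four scalars.** For `2n+3 ≤ d`, `m ≠ 0`, exponents `a`, kept `sin²` at `j₀` and at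
`j₁` (`sin⁴` if `j₀ = j₁`), truncation order `J`, literal table `c′`: if `δ_J(β/d) ≤ δ̄`, `α′_μ ≤ 2πA` and
`η_μ ≤ 2πρ` for every `μ`, and `srwI d (n+1) 0 (e_{j₀}+e_{j₁}) ≤ I`, then
`|Tw_{n+3}[Π_μ cos^{a_μ} sin²_{j₀} sin²_{j₁}](m e_i; β) − (d²/(4(n+1)(n+2)))·Obj_n(P̃(c′))|`
`≤ (((1+2δ̄)^d − 1) + ((A+ρ)^d − A^d))·(c·(d²/((n+1)(n+2)))·I)`, `c = 3` if `j₀ = j₁` else `1`.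
[cite: FitznerVanDerHofstad2016NoBLE, (3.34)–(3.38) p. 1071, §5.1.1 (5.2)–(5.5) pp. 1089–1090, §5.2 (5.9)–(5.10) p. 1092; DLMF, 10.2.2] -/
theorem abs_srwTwist_prodCosPowSinSqSinSq_sub_recurrenceLitObj_le_of_le (n : ℕ) (hd : 2 * n + 3 ≤ d)
    (i j0 j1 : Fin d) {m : ℤ} (hm : m ≠ 0) (β : ℝ) (a : Fin d → ℕ) (J : ℕ) (c' : Fin d → ℕ → ℂ)
    {δb A ρ I : ℝ}
    (hδ : ∑' l : ℕ, |besselJ (l + J + 1) (β / d)| ≤ δb)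
    (hα : ∀ μ, ∑ j ∈ Finset.range (J + 1), (if j = 0 then (1 : ℝ) else 2) * ‖c' μ j‖ ≤ 2 * π * A)
    (hη : ∀ μ, ∑ j ∈ Finset.range (J + 1), (if j = 0 then (1 : ℝ) else 2)
      * ‖2 * π * Complex.I ^ j * (besselJ j (β / d) : ℂ) - c' μ j‖ ≤ 2 * π * ρ)
    (hI : srwI d (n + 1) 0 (Pi.single j0 1 + Pi.single j1 1) ≤ I) :
    |srwTwist d (n + 3) (fun k => ∏ μ, Real.cos (k μ) ^ a μ
        * (if μ = j0 then Real.sin (k μ) ^ 2 else 1) * (if μ = j1 then Real.sin (k μ) ^ 2 else 1))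
        (Pi.single i m) β
      - (d : ℝ) ^ 2 / (4 * ((n + 1) * (n + 2))) * ((n ! : ℝ)⁻¹ * (∫ τ in Ioi (0:ℝ), τ ^ n * (Real.exp (-τ) *
        (∏ μ, ∑ j ∈ Finset.range (J + 1), (if j = 0 then (1 : ℂ) else 2)
          * ((if μ = j0 then
              (if μ = j1 then
                ∑ s ∈ Finset.range (a μ + 1), (((a μ).choose s : ℂ) / 2 ^ (a μ))
                    * ((((((j * m - ((2 * (s : ℤ) - (a μ : ℕ) : ℤ))) : ℤ) : ℝ) + 2) * ((((j * m - ((2 * (s : ℤ) - (a μ : ℕ) : ℤ))) : ℤ) : ℝ) + 3)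
                        * besselI (j * m - ((2 * (s : ℤ) - (a μ : ℕ) : ℤ)) + 2) (τ / d)
                        - 2 * (((j * m - ((2 * (s : ℤ) - (a μ : ℕ) : ℤ))) : ℤ) : ℝ) ^ 2
                            * besselI (j * m - ((2 * (s : ℤ) - (a μ : ℕ) : ℤ))) (τ / d)
                        + ((((j * m - ((2 * (s : ℤ) - (a μ : ℕ) : ℤ))) : ℤ) : ℝ) - 2) * ((((j * m - ((2 * (s : ℤ) - (a μ : ℕ) : ℤ))) : ℤ) : ℝ) - 3)
                            * besselI (j * m - ((2 * (s : ℤ) - (a μ : ℕ) : ℤ)) - 2) (τ / d) : ℝ) : ℂ)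
               else
                ∑ s ∈ Finset.range (a μ + 1), (((a μ).choose s : ℂ) / 2 ^ (a μ))
                    * ((((j * m - ((2 * (s : ℤ) - (a μ : ℕ) : ℤ)) : ℤ) + 1)
                        * besselI (j * m - ((2 * (s : ℤ) - (a μ : ℕ) : ℤ)) + 1) (τ / d)
                        - ((j * m - ((2 * (s : ℤ) - (a μ : ℕ) : ℤ)) : ℤ) - 1)
                            * besselI (j * m - ((2 * (s : ℤ) - (a μ : ℕ) : ℤ)) - 1) (τ / d) : ℝ) : ℂ))
             else
              (if μ = j1 then
                ∑ s ∈ Finset.range (a μ + 1), (((a μ).choose s : ℂ) / 2 ^ (a μ))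
                    * ((((j * m - ((2 * (s : ℤ) - (a μ : ℕ) : ℤ)) : ℤ) + 1)
                        * besselI (j * m - ((2 * (s : ℤ) - (a μ : ℕ) : ℤ)) + 1) (τ / d)
                        - ((j * m - ((2 * (s : ℤ) - (a μ : ℕ) : ℤ)) : ℤ) - 1)
                            * besselI (j * m - ((2 * (s : ℤ) - (a μ : ℕ) : ℤ)) - 1) (τ / d) : ℝ) : ℂ)
               else
                ∑ s ∈ Finset.range (a μ + 1), (((a μ).choose s : ℂ) / 2 ^ (a μ))
                    * (besselI (j * m - ((2 * (s : ℤ) - (a μ : ℕ) : ℤ))) (τ / d) : ℂ)))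
            * c' μ j)).re)) / (2 * π) ^ d)|
    ≤ (((1 + 2 * δb) ^ d - 1) + ((A + ρ) ^ d - A ^ d))
      * ((if j0 = j1 then (3 : ℝ) else 1) * ((d : ℝ) ^ 2 / ((n + 1) * (n + 2))) * I) := by
  have hd' : 2 * (n + 1) + 1 ≤ d := by omega
  have hw : ∀ j : ℕ, (0 : ℝ) ≤ (if j = 0 then (1 : ℝ) else 2) := fun j => by split_ifs <;> norm_num
  have hδ0 : 0 ≤ ∑' l : ℕ, |besselJ (l + J + 1) (β / d)| := tsum_nonneg fun _ => abs_nonneg _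
  have hα0 : ∀ μ : Fin d, 0 ≤ ∑ j ∈ Finset.range (J + 1), (if j = 0 then (1 : ℝ) else 2) * ‖c' μ j‖ :=
    fun μ => Finset.sum_nonneg fun j _ => mul_nonneg (hw j) (norm_nonneg _)
  have hη0 : ∀ μ : Fin d, 0 ≤ ∑ j ∈ Finset.range (J + 1), (if j = 0 then (1 : ℝ) else 2)
      * ‖2 * π * Complex.I ^ j * (besselJ j (β / d) : ℂ) - c' μ j‖ :=
    fun μ => Finset.sum_nonneg fun j _ => mul_nonneg (hw j) (norm_nonneg _)
  have hB := keptBracket_le_of_le (d := d) (∑' l : ℕ, |besselJ (l + J + 1) (β / d)|) δb A ρ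
    (fun μ => ∑ j ∈ Finset.range (J + 1), (if j = 0 then (1 : ℝ) else 2) * ‖c' μ j‖)
    (fun μ => ∑ j ∈ Finset.range (J + 1), (if j = 0 then (1 : ℝ) else 2)
      * ‖2 * π * Complex.I ^ j * (besselJ j (β / d) : ℂ) - c' μ j‖)
    hδ0 hδ hα0 hα hη0 hη
  have hB0 := keptBracket_nonneg (d := d) (∑' l : ℕ, |besselJ (l + J + 1) (β / d)|)
    (fun μ => ∑ j ∈ Finset.range (J + 1), (if j = 0 then (1 : ℝ) else 2) * ‖c' μ j‖)
    (fun μ => ∑ j ∈ Finset.range (J + 1), (if j = 0 then (1 : ℝ) else 2)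
      * ‖2 * π * Complex.I ^ j * (besselJ j (β / d) : ℂ) - c' μ j‖)
    hδ0 hα0 hη0
  have hc0 : (0 : ℝ) ≤ (if j0 = j1 then (3 : ℝ) else 1) := by split_ifs <;> norm_num
  have hK0 : (0 : ℝ) ≤ (if j0 = j1 then (3 : ℝ) else 1) * ((d : ℝ) ^ 2 / ((n + 1) * (n + 2))) :=
    mul_nonneg hc0 (by positivity)
  have hS0 : 0 ≤ (if j0 = j1 then (3 : ℝ) else 1) * ((d : ℝ) ^ 2 / ((n + 1) * (n + 2)))
      * srwI d (n + 1) 0 (Pi.single j0 1 + Pi.single j1 1) :=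
    mul_nonneg hK0 (srwI_nonneg (d := d) (n + 1) hd' 0 _)
  have hS : (if j0 = j1 then (3 : ℝ) else 1) * ((d : ℝ) ^ 2 / ((n + 1) * (n + 2)))
      * srwI d (n + 1) 0 (Pi.single j0 1 + Pi.single j1 1)
      ≤ (if j0 = j1 then (3 : ℝ) else 1) * ((d : ℝ) ^ 2 / ((n + 1) * (n + 2))) * I :=
    mul_le_mul_of_nonneg_left hI hK0
  exact (abs_srwTwist_prodCosPowSinSqSinSq_sub_recurrenceLitObj_le n hd i j0 j1 hm β a J c').trans
    (mul_le_mul hB hS hS0 (hB0.trans hB))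

/-! ### Shared literal table `c′_{μ,j} = 2π iʲ q_j` -/

/-- **One-kept budget, shared real literal table.** With `c′_{μ,j} = 2π iʲ q_j` (`q : ℕ → ℝ`),
`|q_j − J_j(β/d)| ≤ e` for `j ≤ J`, `δ_J(β/d) ≤ δ̄` and `srwI d (n+1) 0 (e_{j₀}) ≤ I`: the one-kept budget is
`≤ (((1+2δ̄)^d − 1) + ((A + (2J+1)e)^d − A^d))·((d/(n+1))·I)`, `A = |q_0| + 2Σ_{1≤j≤J}|q_j|`.
[cite: FitznerVanDerHofstad2016NoBLE, (3.34)–(3.38) p. 1071, §5.1.1 (5.2)–(5.5) pp. 1089–1090, §5.2 (5.9)–(5.10) p. 1092; DLMF, 10.2.2] -/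
theorem abs_srwTwist_prodCosPowSinSq_sub_recurrenceLitObj_le_of_lit (n : ℕ) (hd : 2 * n + 3 ≤ d)
    (i j0 : Fin d) {m : ℤ} (hm : m ≠ 0) (β : ℝ) (a : Fin d → ℕ) (J : ℕ) (q : ℕ → ℝ)
    {δb e I : ℝ}
    (hδ : ∑' l : ℕ, |besselJ (l + J + 1) (β / d)| ≤ δb)
    (he : ∀ j ∈ Finset.range (J + 1), |q j - besselJ j (β / d)| ≤ e)
    (hI : srwI d (n + 1) 0 (Pi.single j0 1) ≤ I) :
    |srwTwist d (n + 2) (fun k => ∏ μ, Real.cos (k μ) ^ a μ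
        * (if μ = j0 then Real.sin (k μ) ^ 2 else 1)) (Pi.single i m) β
      - (d : ℝ) / (2 * (n + 1)) * ((n ! : ℝ)⁻¹ * (∫ τ in Ioi (0:ℝ), τ ^ n * (Real.exp (-τ) *
        (∏ μ, ∑ j ∈ Finset.range (J + 1), (if j = 0 then (1 : ℂ) else 2)
          * ((if μ = j0 then
              ∑ s ∈ Finset.range (a μ + 1), (((a μ).choose s : ℂ) / 2 ^ (a μ))
                    * ((((j * m - ((2 * (s : ℤ) - (a μ : ℕ) : ℤ)) : ℤ) + 1)
                        * besselI (j * m - ((2 * (s : ℤ) - (a μ : ℕ) : ℤ)) + 1) (τ / d)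
                        - ((j * m - ((2 * (s : ℤ) - (a μ : ℕ) : ℤ)) : ℤ) - 1)
                            * besselI (j * m - ((2 * (s : ℤ) - (a μ : ℕ) : ℤ)) - 1) (τ / d) : ℝ) : ℂ)
             else
              ∑ s ∈ Finset.range (a μ + 1), (((a μ).choose s : ℂ) / 2 ^ (a μ))
                    * (besselI (j * m - ((2 * (s : ℤ) - (a μ : ℕ) : ℤ))) (τ / d) : ℂ))
            * (2 * π * Complex.I ^ j * ((q j : ℝ) : ℂ)))).re)) / (2 * π) ^ d)|
    ≤ (((1 + 2 * δb) ^ d - 1)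
        + (((|q 0| + 2 * ∑ j ∈ Finset.range J, |q (j + 1)|) + (2 * J + 1) * e) ^ d
          - (|q 0| + 2 * ∑ j ∈ Finset.range J, |q (j + 1)|) ^ d))
      * ((d : ℝ) / (n + 1) * I) := by
  have hα : ∀ μ : Fin d, ∑ j ∈ Finset.range (J + 1), (if j = 0 then (1 : ℝ) else 2)
      * ‖(fun (_ : Fin d) (j : ℕ) => 2 * π * Complex.I ^ j * ((q j : ℝ) : ℂ)) μ j‖
      ≤ 2 * π * (|q 0| + 2 * ∑ j ∈ Finset.range J, |q (j + 1)|) := fun μ => (sum_weight_norm_lit_eq J q).le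
  have hη : ∀ μ : Fin d, ∑ j ∈ Finset.range (J + 1), (if j = 0 then (1 : ℝ) else 2)
      * ‖2 * π * Complex.I ^ j * (besselJ j (β / d) : ℂ)
          - (fun (_ : Fin d) (j : ℕ) => 2 * π * Complex.I ^ j * ((q j : ℝ) : ℂ)) μ j‖
      ≤ 2 * π * ((2 * J + 1) * e) := fun μ => sum_weight_norm_coeff_sub_lit_le J q (β / d) e he
  exact abs_srwTwist_prodCosPowSinSq_sub_recurrenceLitObj_le_of_le n hd i j0 hm β a J
    (fun _ j => 2 * π * Complex.I ^ j * ((q j : ℝ) : ℂ)) hδ hα hη hI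

/-- **Two-kept budget, shared real literal table.** With `c′_{μ,j} = 2π iʲ q_j` (`q : ℕ → ℝ`),
`|q_j − J_j(β/d)| ≤ e` for `j ≤ J`, `δ_J(β/d) ≤ δ̄` and `srwI d (n+1) 0 (e_{j₀}+e_{j₁}) ≤ I`: the two-kept budget
is `≤ (((1+2δ̄)^d − 1) + ((A + (2J+1)e)^d − A^d))·(c·(d²/((n+1)(n+2)))·I)`, `A = |q_0| + 2Σ_{1≤j≤J}|q_j|`.
[cite: FitznerVanDerHofstad2016NoBLE, (3.34)–(3.38) p. 1071, §5.1.1 (5.2)–(5.5) pp. 1089–1090, §5.2 (5.9)–(5.10) p. 1092; DLMF, 10.2.2] -/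
theorem abs_srwTwist_prodCosPowSinSqSinSq_sub_recurrenceLitObj_le_of_lit (n : ℕ) (hd : 2 * n + 3 ≤ d)
    (i j0 j1 : Fin d) {m : ℤ} (hm : m ≠ 0) (β : ℝ) (a : Fin d → ℕ) (J : ℕ) (q : ℕ → ℝ)
    {δb e I : ℝ}
    (hδ : ∑' l : ℕ, |besselJ (l + J + 1) (β / d)| ≤ δb)
    (he : ∀ j ∈ Finset.range (J + 1), |q j - besselJ j (β / d)| ≤ e)
    (hI : srwI d (n + 1) 0 (Pi.single j0 1 + Pi.single j1 1) ≤ I) :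
    |srwTwist d (n + 3) (fun k => ∏ μ, Real.cos (k μ) ^ a μ
        * (if μ = j0 then Real.sin (k μ) ^ 2 else 1) * (if μ = j1 then Real.sin (k μ) ^ 2 else 1))
        (Pi.single i m) β
      - (d : ℝ) ^ 2 / (4 * ((n + 1) * (n + 2))) * ((n ! : ℝ)⁻¹ * (∫ τ in Ioi (0:ℝ), τ ^ n * (Real.exp (-τ) *
        (∏ μ, ∑ j ∈ Finset.range (J + 1), (if j = 0 then (1 : ℂ) else 2)
          * ((if μ = j0 then
              (if μ = j1 then
                ∑ s ∈ Finset.range (a μ + 1), (((a μ).choose s : ℂ) / 2 ^ (a μ))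
                    * ((((((j * m - ((2 * (s : ℤ) - (a μ : ℕ) : ℤ))) : ℤ) : ℝ) + 2) * ((((j * m - ((2 * (s : ℤ) - (a μ : ℕ) : ℤ))) : ℤ) : ℝ) + 3)
                        * besselI (j * m - ((2 * (s : ℤ) - (a μ : ℕ) : ℤ)) + 2) (τ / d)
                        - 2 * (((j * m - ((2 * (s : ℤ) - (a μ : ℕ) : ℤ))) : ℤ) : ℝ) ^ 2
                            * besselI (j * m - ((2 * (s : ℤ) - (a μ : ℕ) : ℤ))) (τ / d)
                        + ((((j * m - ((2 * (s : ℤ) - (a μ : ℕ) : ℤ))) : ℤ) : ℝ) - 2) * ((((j * m - ((2 * (s : ℤ) - (a μ : ℕ) : ℤ))) : ℤ) : ℝ) - 3)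
                            * besselI (j * m - ((2 * (s : ℤ) - (a μ : ℕ) : ℤ)) - 2) (τ / d) : ℝ) : ℂ)
               else
                ∑ s ∈ Finset.range (a μ + 1), (((a μ).choose s : ℂ) / 2 ^ (a μ))
                    * ((((j * m - ((2 * (s : ℤ) - (a μ : ℕ) : ℤ)) : ℤ) + 1)
                        * besselI (j * m - ((2 * (s : ℤ) - (a μ : ℕ) : ℤ)) + 1) (τ / d)
                        - ((j * m - ((2 * (s : ℤ) - (a μ : ℕ) : ℤ)) : ℤ) - 1)
                            * besselI (j * m - ((2 * (s : ℤ) - (a μ : ℕ) : ℤ)) - 1) (τ / d) : ℝ) : ℂ))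
             else
              (if μ = j1 then
                ∑ s ∈ Finset.range (a μ + 1), (((a μ).choose s : ℂ) / 2 ^ (a μ))
                    * ((((j * m - ((2 * (s : ℤ) - (a μ : ℕ) : ℤ)) : ℤ) + 1)
                        * besselI (j * m - ((2 * (s : ℤ) - (a μ : ℕ) : ℤ)) + 1) (τ / d)
                        - ((j * m - ((2 * (s : ℤ) - (a μ : ℕ) : ℤ)) : ℤ) - 1)
                            * besselI (j * m - ((2 * (s : ℤ) - (a μ : ℕ) : ℤ)) - 1) (τ / d) : ℝ) : ℂ)
               else
                ∑ s ∈ Finset.range (a μ + 1), (((a μ).choose s : ℂ) / 2 ^ (a μ))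
                    * (besselI (j * m - ((2 * (s : ℤ) - (a μ : ℕ) : ℤ))) (τ / d) : ℂ)))
            * (2 * π * Complex.I ^ j * ((q j : ℝ) : ℂ)))).re)) / (2 * π) ^ d)|
    ≤ (((1 + 2 * δb) ^ d - 1)
        + (((|q 0| + 2 * ∑ j ∈ Finset.range J, |q (j + 1)|) + (2 * J + 1) * e) ^ d
          - (|q 0| + 2 * ∑ j ∈ Finset.range J, |q (j + 1)|) ^ d))
      * ((if j0 = j1 then (3 : ℝ) else 1) * ((d : ℝ) ^ 2 / ((n + 1) * (n + 2))) * I) := by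
  have hα : ∀ μ : Fin d, ∑ j ∈ Finset.range (J + 1), (if j = 0 then (1 : ℝ) else 2)
      * ‖(fun (_ : Fin d) (j : ℕ) => 2 * π * Complex.I ^ j * ((q j : ℝ) : ℂ)) μ j‖
      ≤ 2 * π * (|q 0| + 2 * ∑ j ∈ Finset.range J, |q (j + 1)|) := fun μ => (sum_weight_norm_lit_eq J q).le
  have hη : ∀ μ : Fin d, ∑ j ∈ Finset.range (J + 1), (if j = 0 then (1 : ℝ) else 2)
      * ‖2 * π * Complex.I ^ j * (besselJ j (β / d) : ℂ)
          - (fun (_ : Fin d) (j : ℕ) => 2 * π * Complex.I ^ j * ((q j : ℝ) : ℂ)) μ j‖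
      ≤ 2 * π * ((2 * J + 1) * e) := fun μ => sum_weight_norm_coeff_sub_lit_le J q (β / d) e he
  exact abs_srwTwist_prodCosPowSinSqSinSq_sub_recurrenceLitObj_le_of_le n hd i j0 j1 hm β a J
    (fun _ j => 2 * π * Complex.I ^ j * ((q j : ℝ) : ℂ)) hδ hα hη hI

/-! ### Rational inputs: the shape a kernel-decided consumer inequality uses -/

/-- **One-kept budget, rational inputs:** shared rational table `q : ℕ → ℚ` (`c′_{μ,j} = 2π iʲ q_j`),
`|q_j − J_j(β/d)| ≤ e` (`j ≤ J`), `δ_J(β/d) ≤ δ̄`, `srwI d (n+1) 0 (e_{j₀}) ≤ I` with `δ̄, e, I ∈ ℚ` ⇒ the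
one-kept budget is `≤ (((((1+2δ̄)^d − 1) + ((A + (2J+1)e)^d − A^d))·((d/(n+1))·I) : ℚ) : ℝ)`,
`A = |q_0| + 2Σ_{1≤j≤J}|q_j|` — one rational expression in the literals.
[cite: FitznerVanDerHofstad2016NoBLE, (3.34)–(3.38) p. 1071, §5.1.1 (5.2)–(5.5) pp. 1089–1090, §5.2 (5.9)–(5.10) p. 1092; DLMF, 10.2.2] -/
theorem abs_srwTwist_prodCosPowSinSq_sub_recurrenceLitObj_le_of_lit_cast (n : ℕ) (hd : 2 * n + 3 ≤ d)
    (i j0 : Fin d) {m : ℤ} (hm : m ≠ 0) (β : ℝ) (a : Fin d → ℕ) (J : ℕ) (q : ℕ → ℚ)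
    {δb e I : ℚ}
    (hδ : ∑' l : ℕ, |besselJ (l + J + 1) (β / d)| ≤ (δb : ℝ))
    (he : ∀ j ∈ Finset.range (J + 1), |((q j : ℚ) : ℝ) - besselJ j (β / d)| ≤ (e : ℝ))
    (hI : srwI d (n + 1) 0 (Pi.single j0 1) ≤ (I : ℝ)) :
    |srwTwist d (n + 2) (fun k => ∏ μ, Real.cos (k μ) ^ a μ
        * (if μ = j0 then Real.sin (k μ) ^ 2 else 1)) (Pi.single i m) β
      - (d : ℝ) / (2 * (n + 1)) * ((n ! : ℝ)⁻¹ * (∫ τ in Ioi (0:ℝ), τ ^ n * (Real.exp (-τ) *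
        (∏ μ, ∑ j ∈ Finset.range (J + 1), (if j = 0 then (1 : ℂ) else 2)
          * ((if μ = j0 then
              ∑ s ∈ Finset.range (a μ + 1), (((a μ).choose s : ℂ) / 2 ^ (a μ))
                    * ((((j * m - ((2 * (s : ℤ) - (a μ : ℕ) : ℤ)) : ℤ) + 1)
                        * besselI (j * m - ((2 * (s : ℤ) - (a μ : ℕ) : ℤ)) + 1) (τ / d)
                        - ((j * m - ((2 * (s : ℤ) - (a μ : ℕ) : ℤ)) : ℤ) - 1)
                            * besselI (j * m - ((2 * (s : ℤ) - (a μ : ℕ) : ℤ)) - 1) (τ / d) : ℝ) : ℂ)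
             else
              ∑ s ∈ Finset.range (a μ + 1), (((a μ).choose s : ℂ) / 2 ^ (a μ))
                    * (besselI (j * m - ((2 * (s : ℤ) - (a μ : ℕ) : ℤ))) (τ / d) : ℂ))
            * (2 * π * Complex.I ^ j * (((q j : ℚ) : ℝ) : ℂ)))).re)) / (2 * π) ^ d)|
    ≤ (((((1 + 2 * δb) ^ d - 1)
          + (((|q 0| + 2 * ∑ j ∈ Finset.range J, |q (j + 1)|) + (2 * J + 1) * e) ^ d
            - (|q 0| + 2 * ∑ j ∈ Finset.range J, |q (j + 1)|) ^ d))
        * ((d : ℚ) / (n + 1) * I) : ℚ) : ℝ) := by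
  have h := abs_srwTwist_prodCosPowSinSq_sub_recurrenceLitObj_le_of_lit n hd i j0 hm β a J
    (fun j => ((q j : ℚ) : ℝ)) hδ he hI
  have hR : (((((1 + 2 * δb) ^ d - 1)
          + (((|q 0| + 2 * ∑ j ∈ Finset.range J, |q (j + 1)|) + (2 * J + 1) * e) ^ d
            - (|q 0| + 2 * ∑ j ∈ Finset.range J, |q (j + 1)|) ^ d))
        * ((d : ℚ) / (n + 1) * I) : ℚ) : ℝ)
      = (((1 + 2 * (δb : ℝ)) ^ d - 1)
          + (((|((q 0 : ℚ) : ℝ)| + 2 * ∑ j ∈ Finset.range J, |((q (j + 1) : ℚ) : ℝ)|) + (2 * J + 1) * (e : ℝ)) ^ d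
            - (|((q 0 : ℚ) : ℝ)| + 2 * ∑ j ∈ Finset.range J, |((q (j + 1) : ℚ) : ℝ)|) ^ d))
        * ((d : ℝ) / (n + 1) * (I : ℝ)) := by
    push_cast
    ring
  rw [hR]
  exact h

/-- **Two-kept budget, rational inputs:** shared rational table `q : ℕ → ℚ`, `|q_j − J_j(β/d)| ≤ e` (`j ≤ J`),
`δ_J(β/d) ≤ δ̄`, `srwI d (n+1) 0 (e_{j₀}+e_{j₁}) ≤ I` with `δ̄, e, I ∈ ℚ` ⇒ the two-kept budget is
`≤ (((((1+2δ̄)^d − 1) + ((A + (2J+1)e)^d − A^d))·(c·(d²/((n+1)(n+2)))·I) : ℚ) : ℝ)`, `A = |q_0| + 2Σ_{1≤j≤J}|q_j|`,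
`c = 3` if `j₀ = j₁` else `1` — one rational expression in the literals.
[cite: FitznerVanDerHofstad2016NoBLE, (3.34)–(3.38) p. 1071, §5.1.1 (5.2)–(5.5) pp. 1089–1090, §5.2 (5.9)–(5.10) p. 1092; DLMF, 10.2.2] -/
theorem abs_srwTwist_prodCosPowSinSqSinSq_sub_recurrenceLitObj_le_of_lit_cast (n : ℕ)
    (hd : 2 * n + 3 ≤ d) (i j0 j1 : Fin d) {m : ℤ} (hm : m ≠ 0) (β : ℝ) (a : Fin d → ℕ) (J : ℕ)
    (q : ℕ → ℚ)
    {δb e I : ℚ}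
    (hδ : ∑' l : ℕ, |besselJ (l + J + 1) (β / d)| ≤ (δb : ℝ))
    (he : ∀ j ∈ Finset.range (J + 1), |((q j : ℚ) : ℝ) - besselJ j (β / d)| ≤ (e : ℝ))
    (hI : srwI d (n + 1) 0 (Pi.single j0 1 + Pi.single j1 1) ≤ (I : ℝ)) :
    |srwTwist d (n + 3) (fun k => ∏ μ, Real.cos (k μ) ^ a μ
        * (if μ = j0 then Real.sin (k μ) ^ 2 else 1) * (if μ = j1 then Real.sin (k μ) ^ 2 else 1))
        (Pi.single i m) β
      - (d : ℝ) ^ 2 / (4 * ((n + 1) * (n + 2))) * ((n ! : ℝ)⁻¹ * (∫ τ in Ioi (0:ℝ), τ ^ n * (Real.exp (-τ) *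
        (∏ μ, ∑ j ∈ Finset.range (J + 1), (if j = 0 then (1 : ℂ) else 2)
          * ((if μ = j0 then
              (if μ = j1 then
                ∑ s ∈ Finset.range (a μ + 1), (((a μ).choose s : ℂ) / 2 ^ (a μ))
                    * ((((((j * m - ((2 * (s : ℤ) - (a μ : ℕ) : ℤ))) : ℤ) : ℝ) + 2) * ((((j * m - ((2 * (s : ℤ) - (a μ : ℕ) : ℤ))) : ℤ) : ℝ) + 3)
                        * besselI (j * m - ((2 * (s : ℤ) - (a μ : ℕ) : ℤ)) + 2) (τ / d)
                        - 2 * (((j * m - ((2 * (s : ℤ) - (a μ : ℕ) : ℤ))) : ℤ) : ℝ) ^ 2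
                            * besselI (j * m - ((2 * (s : ℤ) - (a μ : ℕ) : ℤ))) (τ / d)
                        + ((((j * m - ((2 * (s : ℤ) - (a μ : ℕ) : ℤ))) : ℤ) : ℝ) - 2) * ((((j * m - ((2 * (s : ℤ) - (a μ : ℕ) : ℤ))) : ℤ) : ℝ) - 3)
                            * besselI (j * m - ((2 * (s : ℤ) - (a μ : ℕ) : ℤ)) - 2) (τ / d) : ℝ) : ℂ)
               else
                ∑ s ∈ Finset.range (a μ + 1), (((a μ).choose s : ℂ) / 2 ^ (a μ))
                    * ((((j * m - ((2 * (s : ℤ) - (a μ : ℕ) : ℤ)) : ℤ) + 1)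
                        * besselI (j * m - ((2 * (s : ℤ) - (a μ : ℕ) : ℤ)) + 1) (τ / d)
                        - ((j * m - ((2 * (s : ℤ) - (a μ : ℕ) : ℤ)) : ℤ) - 1)
                            * besselI (j * m - ((2 * (s : ℤ) - (a μ : ℕ) : ℤ)) - 1) (τ / d) : ℝ) : ℂ))
             else
              (if μ = j1 then
                ∑ s ∈ Finset.range (a μ + 1), (((a μ).choose s : ℂ) / 2 ^ (a μ))
                    * ((((j * m - ((2 * (s : ℤ) - (a μ : ℕ) : ℤ)) : ℤ) + 1)
                        * besselI (j * m - ((2 * (s : ℤ) - (a μ : ℕ) : ℤ)) + 1) (τ / d)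
                        - ((j * m - ((2 * (s : ℤ) - (a μ : ℕ) : ℤ)) : ℤ) - 1)
                            * besselI (j * m - ((2 * (s : ℤ) - (a μ : ℕ) : ℤ)) - 1) (τ / d) : ℝ) : ℂ)
               else
                ∑ s ∈ Finset.range (a μ + 1), (((a μ).choose s : ℂ) / 2 ^ (a μ))
                    * (besselI (j * m - ((2 * (s : ℤ) - (a μ : ℕ) : ℤ))) (τ / d) : ℂ)))
            * (2 * π * Complex.I ^ j * (((q j : ℚ) : ℝ) : ℂ)))).re)) / (2 * π) ^ d)|
    ≤ (((((1 + 2 * δb) ^ d - 1)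
          + (((|q 0| + 2 * ∑ j ∈ Finset.range J, |q (j + 1)|) + (2 * J + 1) * e) ^ d
            - (|q 0| + 2 * ∑ j ∈ Finset.range J, |q (j + 1)|) ^ d))
        * ((if j0 = j1 then (3 : ℚ) else 1) * ((d : ℚ) ^ 2 / ((n + 1) * (n + 2))) * I) : ℚ) : ℝ) := by
  have h := abs_srwTwist_prodCosPowSinSqSinSq_sub_recurrenceLitObj_le_of_lit n hd i j0 j1 hm β a J
    (fun j => ((q j : ℚ) : ℝ)) hδ he hI
  have hR : (((((1 + 2 * δb) ^ d - 1)
          + (((|q 0| + 2 * ∑ j ∈ Finset.range J, |q (j + 1)|) + (2 * J + 1) * e) ^ d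
            - (|q 0| + 2 * ∑ j ∈ Finset.range J, |q (j + 1)|) ^ d))
        * ((if j0 = j1 then (3 : ℚ) else 1) * ((d : ℚ) ^ 2 / ((n + 1) * (n + 2))) * I) : ℚ) : ℝ)
      = (((1 + 2 * (δb : ℝ)) ^ d - 1)
          + (((|((q 0 : ℚ) : ℝ)| + 2 * ∑ j ∈ Finset.range J, |((q (j + 1) : ℚ) : ℝ)|) + (2 * J + 1) * (e : ℝ)) ^ d
            - (|((q 0 : ℚ) : ℝ)| + 2 * ∑ j ∈ Finset.range J, |((q (j + 1) : ℚ) : ℝ)|) ^ d))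
        * ((if j0 = j1 then (3 : ℝ) else 1) * ((d : ℝ) ^ 2 / ((n + 1) * (n + 2))) * (I : ℝ)) := by
    split_ifs <;> push_cast <;> ring
  rw [hR]
  exact h

end Literature.Probability.FitznerVanDerHofstad2017

end
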